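import Mathlib

/-!
# `Balaban1983to89.Beta.TransverseStructure` — the continuum transverse tensor
`T_{μν} = (∂_μ∂_ν − δ_{μν}Δ)|x|⁻⁴` on `ℝ⁴ ∖ 0`: Hessian identity, transversality, the ONE-SCALAR lemma, and (v1.1) the
O(4)-covariance CLASSIFICATION behind it
(β sub-cell row lit1 gen 3 / gen 4; calculus complement of row an3-g3's (L5) node `Beta/LeadingCoefficient`)

HONEST FRAMING (cell `pub-balaban`, verbatim rule): discharging `BetaPertH` makes Bałaban's UV stability UNCONDITIONAL —
a real constructive-QFT result; it is NOT the continuum limit and NOT the Clay problem.  THIS MODULE DISCHARGES NOTHING of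
the series and asserts NOTHING about Bałaban's papers: it is elementary multivariable calculus on `ℝ⁴ ∖ 0`, written along
coordinate lines (`Function.update x μ t`) so that every "∂_μ" below is an honest one-variable `HasDerivAt` certificate.
Value = kernel certificate of an elementary structural step in the typing of item (L5) of the β sub-cell's one open
statement (M2⁺) (BETA-SPEC v1.8e §8.6(m)/(p): `(M2⁺) ⟸ WindowDecomposition ∧ I > 0`, and «I > 0 is EXACTLY κ > 0 once the
leading kernel is κ × the transverse structure `x_μx_ν(∂_μ∂_ν − δ_{μν}Δ)|x|⁻⁴ = 24κ·x_μ²x_ν²/|x|⁸`»), NOT summit progress.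

PRINTED CONTEXT (dictionary only; nothing below is used as a hypothesis).  The tensor `(∂_μ∂_ν − δ_{μν}□)|x−y|^{4−2d}` is the
position-space form of the continuum one-loop background-field vacuum polarisation at separated points: G. Dunne, N. Rius,
Phys. Lett. B 293 (1992) 367 = hep-th/9206038, eq. (15) «the manifestly transverse expression Ω₂(B) = −(g₀²μ^{4−d}/2)·C_A·
(−Γ(d/2−1)/(4π^{d/2}))²·((8 − (15/2)d)/(2 − 2d)) ∫dᵈx dᵈy B^a_μ(x)B^a_ν(y)(∂_μ∂_ν − δ_{μν}□)|x−y|^{4−2d}» [DunneRius1992],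
restating D. Z. Freedman, K. Johnson, J. I. Latorre, Nucl. Phys. B 371 (1992) 353, (II.G.22) [FreedmanJohnsonLatorre1992];
at `d = 4` the coefficient `(8 − 30)/(2 − 8) = 11/3` is the asymptotic-freedom number (cell records: CITED-FACTS S-lit1-17,
HOME/BETA/LIT1.md v1.4 §9.1, two-engine reproduction in HOME/b2b-balaban-beta-lit1/gen3/).  Physics literature ⇒ CONTEXT
only under the cell's ABSOLUTE RULE; this file proves only the `d = 4` tensor calculus of that structure.

WHAT IS PROVED (all `[folklore]`, Mathlib only; `x : Fin 4 → ℝ`, `r2 x = Σ xᵢ²`, everything at points `x ≠ 0`):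
* §1 `r2`, `rest μ x = Σ_{i≠μ} xᵢ²`, `r2 (update x μ t) = t² + rest μ x` — the coordinate-line reduction; one-variable
  helpers `d/dt ((t²+c)^k)⁻¹ = −2kt/(t²+c)^{k+1}`, `k = 2, 3, 4`.
* §2 the partials of `|x|⁻⁴ = 1/r2²` as `HasDerivAt` facts: `∂_μ(1/r2²) = −4x_μ/r2³` (`hasDerivAt_invQuartic`),
  `∂_ν(−4x_μ/r2³) = 24x_μx_ν/r2⁴ − 4δ_{μν}/r2³` (`hasDerivAt_d1InvQuartic`), trace `Σ_μ ∂_μ∂_μ(1/r2²) = 8/r2³`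
  (`sum_hess_eq_lap`); hence the HESSIAN IDENTITY `transverse μ ν x := hess − δ·lap = 24x_μx_ν/r2⁴ − 12δ_{μν}/r2³`
  (`transverse_eq`).
* §3 the O(4)-covariant two-parameter family `covFamily a b μ ν x = b·x_μx_ν/r2⁴ + a·δ_{μν}/r2³` (the general covariant
  symmetric 2-tensor homogeneous of degree −6 — in v1 the covariance CLASSIFICATION was not formalised and the family was
  the hypothesis; v1.1 §5 PROVES it): its coordinate divergence terms as `HasDerivAt` facts (`hasDerivAt_covFamily`) and their sum
  `Σ_μ ∂_μ S^{a,b}_{μν} = (−6a − 3b)·x_ν/r2⁴` (`sum_divTerm`); so TRANSVERSALITY of `T = S^{−12,24}` (`transverse_divFree`,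
  `hasDerivAt_transverse`), and the ONE-SCALAR LEMMA: `S^{a,b}` is divergence-free on `ℝ⁴ ∖ 0` iff `b = −2a`
  (`divFree_iff`), in which case `S^{a,−2a} = (−a/12)·T` (`covFamily_eq_smul_transverse`) — background-gauge
  transversality at `x ≠ 0` leaves one scalar in front of `T`.
* §4 the off-diagonal moment `x_μx_ν·T_{μν} = 24x_μ²x_ν²/r2⁴` (`offDiag_moment`), its sign and degree-(−4) homogeneity —
  the closed form row an3-g3's `HomogKernel` instance starts from (`Beta/LeadingCoefficient.transverseUnit`, p179240;
  AN3.md v3 §6.2 cites §§2–3 of this file by name); `sign_of_scalar_multiple`.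
* §5 (v1.1) THE O(4)-COVARIANCE CLASSIFICATION, now a theorem: for a matrix field `S` on `ℝ⁴` with `S(Ax) = A S(x) Aᵀ`
  for all real orthogonal `A` and all `x ≠ 0` (`IsO4Covariant`), `S(x) = α(|x|)·1 + β(|x|)·x xᵀ` (`o4_classification`,
  Householder + sign flips + transpositions fixing `e₀`; symmetry is a consequence, not a hypothesis); with degree-(−6)
  homogeneity (`IsHomogNegSix`) `S = covFamily a b` entrywise (`eq_covFamily_of_covariant`); with the honest coordinate
  divergence `coordDiv` (one-variable `deriv` along coordinate lines, = v1's certified `divTerm` sums,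
  `coordDiv_eq_sum_divTerm`) the ONE-SCALAR THEOREM `one_scalar`/`one_scalar_matrix`: covariant + homogeneous +
  divergence-free ⇒ `S = κ·T`, `κ = −S(e₀)₁₁/12`; and the converse `smul_transverseField_covariant/_homog/_divFree` — the
  three hypotheses cut out exactly `ℝ·T` (this closes the «[analysis, classical]» classification sentence of AN3.md v3
  §6.2 (n3) and v1's «not formalised»).
* §6 (v1.1) the LOCAL HYPERCUBIC family `L^{a,b,c} = (a·δΔ + b·∂∂ + c·δ_{μν}∂_μ²)|x|⁻⁴` (the anisotropic member allowed by
  lattice symmetry for polynomial log-coefficients): certified divergence `(−48a−48b+72c)x_ν/r2⁴ − 192c·x_ν³/r2⁵`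
  (`hasDerivAt_localFamily`, `sum_divTermLocal`) and `localFamily_divFree_iff`: divergence-free ⇔ `c = 0 ∧ a = −b` ⇔
  `L = b·T` (`localFamily_maxwell`) — with the honest scope note that NON-local hypercubic anisotropies (AN3 §6.2's caveat)
  are not of this form and are excluded from the leading kernel only by rows (L1)(β)/(L2).
WHAT IS NOT PROVED: anything about Bałaban's kernels; that the leading window kernel of (1.22) is O(4)-covariant (needs the
(R1) Landau/R-gauge road and (L1)(β)/(L2) — an axial-type representation is transverse but only axially covariant, and
hypercubic covariance alone admits non-local transverse anisotropies, §6 note); any Fourier statement (`FT|x|⁻⁴ = −π²ln p²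
+ c`); any value of κ.  Companion prose: HOME/BETA/LIT1.md v1.4–v1.6 §9; journal CLAIM L5-TRANSVERSE-STRUCTURE-CALCULUS
2026-08-18 (yield clause to an3-g3; an3-g3 NOTE 20:36:33Z: cited by name, not absorbed) and CLAIM «BETA-lit1 gen 4».
VERSION LOG: v1 p179263 (2026-08-18, commit 8fc982457594; XREAD ok pv28-g3 C-pv28g3-3): §§1–4.  v1.1 (gen 4): §§5–6
APPENDED, every v1 declaration byte-unchanged; header bullets §3/§4 amended accordingly; `open Matrix` from §5 on.
-/

namespace Literature.MathematicalPhysics.QuantumFieldTheory.Balaban1983to89.Beta.TransverseStructure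

open Finset

noncomputable section

/-- Points of `ℝ⁴` as coordinate functions. [folklore] -/
abbrev E4 : Type := Fin 4 → ℝ

/-! ## §1. Squared radius, the coordinate-line reduction, one-variable helpers -/

/-- The squared Euclidean radius `r2 x = Σᵢ xᵢ²`. [folklore] -/
def r2 (x : E4) : ℝ := ∑ i, x i ^ 2

/-- The squared radius of the OTHER coordinates, `rest μ x = Σ_{i ≠ μ} xᵢ²`. [folklore] -/
def rest (μ : Fin 4) (x : E4) : ℝ := ∑ i ∈ univ.erase μ, x i ^ 2

/-- `r2 x = x_μ² + rest μ x`. [folklore] -/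
theorem r2_eq_sq_add_rest (μ : Fin 4) (x : E4) : r2 x = x μ ^ 2 + rest μ x := by
  unfold r2 rest
  exact (Finset.add_sum_erase _ _ (mem_univ μ)).symm

/-- `rest μ x ≥ 0`. [folklore] -/
theorem rest_nonneg (μ : Fin 4) (x : E4) : 0 ≤ rest μ x :=
  Finset.sum_nonneg fun i _ => sq_nonneg (x i)

/-- `r2 x ≥ 0`. [folklore] -/
theorem r2_nonneg (x : E4) : 0 ≤ r2 x :=
  Finset.sum_nonneg fun i _ => sq_nonneg (x i)

/-- `r2 x > 0` off the origin. [folklore] -/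
theorem r2_pos {x : E4} (hx : x ≠ 0) : 0 < r2 x := by
  obtain ⟨i, hi⟩ : ∃ i, x i ≠ 0 := by
    by_contra h
    push Not at h
    exact hx (funext h)
  unfold r2
  exact lt_of_lt_of_le (by positivity : 0 < x i ^ 2)
    (Finset.single_le_sum (fun j _ => sq_nonneg (x j)) (mem_univ i))

/-- Moving along the `μ`-th coordinate line does not change `rest μ`. [folklore] -/
theorem rest_update (μ : Fin 4) (x : E4) (t : ℝ) : rest μ (Function.update x μ t) = rest μ x := by
  unfold rest
  refine Finset.sum_congr rfl fun i hi => ?_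
  rw [Function.update_of_ne (Finset.ne_of_mem_erase hi)]

/-- THE COORDINATE-LINE REDUCTION: `r2 (update x μ t) = t² + rest μ x`. [folklore] -/
theorem r2_update (μ : Fin 4) (x : E4) (t : ℝ) : r2 (Function.update x μ t) = t ^ 2 + rest μ x := by
  rw [r2_eq_sq_add_rest μ, Function.update_self, rest_update]

/-- Along the `ν`-th line, another coordinate `μ ≠ ν` is constant. [folklore] -/
theorem update_apply_of_ne {μ ν : Fin 4} (h : μ ≠ ν) (x : E4) (t : ℝ) : Function.update x ν t μ = x μ :=
  Function.update_of_ne h t x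

/-- `x ≠ 0 ⇒ x_μ² + rest μ x ≠ 0` (the denominator along a coordinate line, at the base point). [folklore] -/
theorem sq_add_rest_ne_zero (μ : Fin 4) {x : E4} (hx : x ≠ 0) : x μ ^ 2 + rest μ x ≠ 0 := by
  rw [← r2_eq_sq_add_rest]
  exact (r2_pos hx).ne'

/-- Scaling: `r2 (t • x) = t²·r2 x`. [folklore] -/
theorem r2_smul (t : ℝ) (x : E4) : r2 (t • x) = t ^ 2 * r2 x := by
  unfold r2
  rw [Finset.mul_sum]
  refine Finset.sum_congr rfl fun i _ => ?_
  simp [Pi.smul_apply, smul_eq_mul, mul_pow]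

/-- `d/dt (t² + c) = 2t`. [folklore] -/
theorem hasDerivAt_sq_add_const (c t₀ : ℝ) : HasDerivAt (fun t : ℝ => t ^ 2 + c) (2 * t₀) t₀ := by
  simpa using (hasDerivAt_pow 2 t₀).add_const c

/-- `d/dt ((t²+c)²)⁻¹ = −4t/(t²+c)³` where `t₀² + c ≠ 0`. [folklore] -/
theorem hasDerivAt_invPow2 (c t₀ : ℝ) (h : t₀ ^ 2 + c ≠ 0) :
    HasDerivAt (fun t : ℝ => ((t ^ 2 + c) ^ 2)⁻¹) (-(4 * t₀) / (t₀ ^ 2 + c) ^ 3) t₀ := by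
  refine (((hasDerivAt_sq_add_const c t₀).fun_pow 2).fun_inv (pow_ne_zero _ h)).congr_deriv ?_
  norm_num
  field_simp
  ring

/-- `d/dt ((t²+c)³)⁻¹ = −6t/(t²+c)⁴` where `t₀² + c ≠ 0`. [folklore] -/
theorem hasDerivAt_invPow3 (c t₀ : ℝ) (h : t₀ ^ 2 + c ≠ 0) :
    HasDerivAt (fun t : ℝ => ((t ^ 2 + c) ^ 3)⁻¹) (-(6 * t₀) / (t₀ ^ 2 + c) ^ 4) t₀ := by
  refine (((hasDerivAt_sq_add_const c t₀).fun_pow 3).fun_inv (pow_ne_zero _ h)).congr_deriv ?_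
  norm_num
  field_simp
  ring

/-- `d/dt ((t²+c)⁴)⁻¹ = −8t/(t²+c)⁵` where `t₀² + c ≠ 0`. [folklore] -/
theorem hasDerivAt_invPow4 (c t₀ : ℝ) (h : t₀ ^ 2 + c ≠ 0) :
    HasDerivAt (fun t : ℝ => ((t ^ 2 + c) ^ 4)⁻¹) (-(8 * t₀) / (t₀ ^ 2 + c) ^ 5) t₀ := by
  refine (((hasDerivAt_sq_add_const c t₀).fun_pow 4).fun_inv (pow_ne_zero _ h)).congr_deriv ?_
  norm_num
  field_simp
  ring

/-! ## §2. The partials of `|x|⁻⁴ = 1/r2²` and the Hessian identity -/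

/-- `|x|₂⁻⁴` as `1/r2²`. [folklore] -/
def invQuartic (x : E4) : ℝ := 1 / r2 x ^ 2

/-- Closed form of the first partials: `∂_μ |x|⁻⁴ = −4x_μ/r2³`. [folklore] -/
def d1InvQuartic (μ : Fin 4) (x : E4) : ℝ := -4 * x μ / r2 x ^ 3

/-- Closed form of the second partials: `∂_ν∂_μ |x|⁻⁴ = 24x_μx_ν/r2⁴ − 4δ_{μν}/r2³`. [folklore] -/
def hessInvQuartic (μ ν : Fin 4) (x : E4) : ℝ :=
  24 * x μ * x ν / r2 x ^ 4 - if μ = ν then 4 / r2 x ^ 3 else 0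

/-- Closed form of the Laplacian in `d = 4`: `Δ|x|⁻⁴ = 8/r2³`. [folklore] -/
def lapInvQuartic (x : E4) : ℝ := 8 / r2 x ^ 3

/-- **First partials, certified**: along the `μ`-th coordinate line through `x ≠ 0`, `t ↦ |update x μ t|⁻⁴` has derivative
`−4x_μ/r2³` at `t = x_μ`. [folklore] -/
theorem hasDerivAt_invQuartic (μ : Fin 4) {x : E4} (hx : x ≠ 0) :
    HasDerivAt (fun t => invQuartic (Function.update x μ t)) (d1InvQuartic μ x) (x μ) := by
  have hne := sq_add_rest_ne_zero μ hx
  have key := hasDerivAt_invPow2 (rest μ x) (x μ) hne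
  have hfun : (fun t => invQuartic (Function.update x μ t)) = fun t : ℝ => ((t ^ 2 + rest μ x) ^ 2)⁻¹ := by
    funext t
    rw [invQuartic, r2_update, one_div]
  rw [hfun]
  refine key.congr_deriv ?_
  rw [d1InvQuartic, r2_eq_sq_add_rest μ x]
  ring

/-- **Second partials, certified**: along the `ν`-th line, `t ↦ (−4x_μ/r2³)(update x ν t)` has derivative
`24x_μx_ν/r2⁴ − 4δ_{μν}/r2³` at `t = x_ν`. [folklore] -/
theorem hasDerivAt_d1InvQuartic (μ ν : Fin 4) {x : E4} (hx : x ≠ 0) :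
    HasDerivAt (fun t => d1InvQuartic μ (Function.update x ν t)) (hessInvQuartic μ ν x) (x ν) := by
  have hne := sq_add_rest_ne_zero ν hx
  have h3 := hasDerivAt_invPow3 (rest ν x) (x ν) hne
  by_cases hμν : μ = ν
  · subst hμν
    -- `t ↦ −4 t /(t²+c)³`
    have key := ((hasDerivAt_id (x μ)).fun_mul h3).const_mul (-4)
    have hfun : (fun t => d1InvQuartic μ (Function.update x μ t)) =
        fun t : ℝ => -4 * (id t * ((t ^ 2 + rest μ x) ^ 3)⁻¹) := by
      funext t
      simp only [d1InvQuartic, r2_update, Function.update_self, id_eq]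
      ring
    rw [hfun]
    refine key.congr_deriv ?_
    rw [hessInvQuartic, if_pos rfl, r2_eq_sq_add_rest μ x, id_eq]
    field_simp
    ring
  · -- `t ↦ −4 x_μ /(t²+c)³`
    have key := h3.const_mul (-4 * x μ)
    have hfun : (fun t => d1InvQuartic μ (Function.update x ν t)) =
        fun t : ℝ => -4 * x μ * ((t ^ 2 + rest ν x) ^ 3)⁻¹ := by
      funext t
      rw [d1InvQuartic, r2_update, update_apply_of_ne hμν]
      ring
    rw [hfun]
    refine key.congr_deriv ?_
    rw [hessInvQuartic, if_neg hμν, r2_eq_sq_add_rest ν x]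
    field_simp
    ring

/-- The trace of the Hessian is the `d = 4` Laplacian: `Σ_μ (24x_μ²/r2⁴ − 4/r2³) = 8/r2³`. [folklore] -/
theorem sum_hess_eq_lap {x : E4} (hx : x ≠ 0) : ∑ μ, hessInvQuartic μ μ x = lapInvQuartic x := by
  have hr : r2 x ≠ 0 := (r2_pos hx).ne'
  have hr' : r2 x = x 0 ^ 2 + x 1 ^ 2 + x 2 ^ 2 + x 3 ^ 2 := by
    simp [r2, Fin.sum_univ_four]
  simp only [hessInvQuartic, lapInvQuartic, Fin.sum_univ_four, if_true]
  field_simp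
  rw [hr']
  ring

/-- **THE TRANSVERSE STRUCTURE** `T_{μν} := ∂_μ∂_ν|x|⁻⁴ − δ_{μν}Δ|x|⁻⁴`, assembled from the certified closed forms.
[folklore] -/
def transverse (μ ν : Fin 4) (x : E4) : ℝ :=
  hessInvQuartic μ ν x - if μ = ν then lapInvQuartic x else 0

/-- **HESSIAN IDENTITY** (the `d = 4` case of Dunne–Rius (15) / the structure of BETA-SPEC §8.6(p)):
`(∂_μ∂_ν − δ_{μν}Δ)|x|⁻⁴ = 24x_μx_ν/r2⁴ − 12δ_{μν}/r2³`. [folklore] -/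
theorem transverse_eq (μ ν : Fin 4) (x : E4) :
    transverse μ ν x = 24 * x μ * x ν / r2 x ^ 4 - if μ = ν then 12 / r2 x ^ 3 else 0 := by
  unfold transverse hessInvQuartic lapInvQuartic
  split_ifs <;> ring

/-- `T` is symmetric. [folklore] -/
theorem transverse_symm (μ ν : Fin 4) (x : E4) : transverse μ ν x = transverse ν μ x := by
  rw [transverse_eq, transverse_eq]
  by_cases h : μ = ν
  · subst h; rfl
  · rw [if_neg h, if_neg (Ne.symm h)]; ring

/-! ## §3. The covariant family, its divergence, transversality, and the one-scalar lemma -/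

/-- The O(4)-covariant two-parameter family of symmetric 2-tensors homogeneous of degree `−6`:
`S^{a,b}_{μν}(x) = b·x_μx_ν/r2⁴ + a·δ_{μν}/r2³`. [folklore] -/
def covFamily (a b : ℝ) (μ ν : Fin 4) (x : E4) : ℝ :=
  b * x μ * x ν / r2 x ^ 4 + if μ = ν then a / r2 x ^ 3 else 0

/-- `T = S^{−12,24}`. [folklore] -/
theorem transverse_eq_covFamily (μ ν : Fin 4) (x : E4) : transverse μ ν x = covFamily (-12) 24 μ ν x := by
  rw [transverse_eq, covFamily]
  split_ifs <;> ring

/-- Closed form of the divergence TERMS `∂_μ S^{a,b}_{μν}` (no sum), along the `μ`-th line. [folklore] -/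
def divTerm (a b : ℝ) (μ ν : Fin 4) (x : E4) : ℝ :=
  if μ = ν then ((-6) * a + 2 * b) * x ν / r2 x ^ 4 - 8 * b * x ν ^ 3 / r2 x ^ 5
  else b * x ν / r2 x ^ 4 - 8 * b * x μ ^ 2 * x ν / r2 x ^ 5

/-- **Divergence terms, certified**: along the `μ`-th coordinate line through `x ≠ 0`,
`t ↦ S^{a,b}_{μν}(update x μ t)` has derivative `divTerm a b μ ν x` at `t = x_μ`. [folklore] -/
theorem hasDerivAt_covFamily (a b : ℝ) (μ ν : Fin 4) {x : E4} (hx : x ≠ 0) :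
    HasDerivAt (fun t => covFamily a b μ ν (Function.update x μ t)) (divTerm a b μ ν x) (x μ) := by
  have hne := sq_add_rest_ne_zero μ hx
  have h3 := hasDerivAt_invPow3 (rest μ x) (x μ) hne
  have h4 := hasDerivAt_invPow4 (rest μ x) (x μ) hne
  by_cases hμν : μ = ν
  · subst hμν
    -- `t ↦ b t²/(t²+c)⁴ + a/(t²+c)³`
    have key := (((hasDerivAt_pow 2 (x μ)).fun_mul h4).const_mul b).fun_add (h3.const_mul a)
    have hfun : (fun t => covFamily a b μ μ (Function.update x μ t)) =
        fun t : ℝ => b * (t ^ 2 * ((t ^ 2 + rest μ x) ^ 4)⁻¹) + a * ((t ^ 2 + rest μ x) ^ 3)⁻¹ := by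
      funext t
      rw [covFamily, if_pos rfl, r2_update, Function.update_self]
      ring
    rw [hfun]
    refine key.congr_deriv ?_
    rw [divTerm, if_pos rfl, r2_eq_sq_add_rest μ x]
    norm_num
    field_simp
    ring
  · -- `t ↦ b t x_ν/(t²+c)⁴`
    have key := ((hasDerivAt_id (x μ)).fun_mul h4).const_mul (b * x ν)
    have hfun : (fun t => covFamily a b μ ν (Function.update x μ t)) =
        fun t : ℝ => b * x ν * (id t * ((t ^ 2 + rest μ x) ^ 4)⁻¹) := by
      funext t
      simp only [covFamily, if_neg hμν, r2_update, Function.update_self, update_apply_of_ne (Ne.symm hμν), id_eq]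
      ring
    rw [hfun]
    refine key.congr_deriv ?_
    rw [divTerm, if_neg hμν, r2_eq_sq_add_rest μ x, id_eq]
    field_simp
    ring

/-- **THE DIVERGENCE OF THE FAMILY**: `Σ_μ ∂_μ S^{a,b}_{μν}(x) = (−6a − 3b)·x_ν/r2⁴` at every `x ≠ 0`. [folklore] -/
theorem sum_divTerm (a b : ℝ) (ν : Fin 4) {x : E4} (hx : x ≠ 0) :
    ∑ μ, divTerm a b μ ν x = ((-6) * a - 3 * b) * x ν / r2 x ^ 4 := by
  have hr : r2 x ≠ 0 := (r2_pos hx).ne'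
  have hr' : r2 x = x 0 ^ 2 + x 1 ^ 2 + x 2 ^ 2 + x 3 ^ 2 := by
    simp [r2, Fin.sum_univ_four]
  fin_cases ν <;>
    · simp [divTerm, Fin.sum_univ_four]
      field_simp
      rw [hr']
      ring

/-- **TRANSVERSALITY of `T`**: `Σ_μ ∂_μ T_{μν} = 0` on `ℝ⁴ ∖ 0` (each `∂_μ` certified by `hasDerivAt_transverse`).
[folklore] -/
theorem transverse_divFree (ν : Fin 4) {x : E4} (hx : x ≠ 0) : ∑ μ, divTerm (-12) 24 μ ν x = 0 := by
  rw [sum_divTerm (-12) 24 ν hx]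
  ring

/-- The certified derivative statement behind `transverse_divFree`: along each coordinate line the entries of `T`
have the derivatives `divTerm (−12) 24`. [folklore] -/
theorem hasDerivAt_transverse (μ ν : Fin 4) {x : E4} (hx : x ≠ 0) :
    HasDerivAt (fun t => transverse μ ν (Function.update x μ t)) (divTerm (-12) 24 μ ν x) (x μ) := by
  have h := hasDerivAt_covFamily (-12) 24 μ ν hx
  have hfun : (fun t => transverse μ ν (Function.update x μ t)) =
      fun t => covFamily (-12) 24 μ ν (Function.update x μ t) := by
    funext t
    rw [transverse_eq_covFamily]
  rw [hfun]
  exact h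

/-- **THE ONE-SCALAR LEMMA**: the covariant family `S^{a,b}` is divergence-free on `ℝ⁴ ∖ 0` if and only if `b = −2a`.
(Background-gauge transversality at separated points therefore leaves ONE scalar in front of `T`.) [folklore] -/
theorem divFree_iff (a b : ℝ) :
    (∀ x : E4, x ≠ 0 → ∀ ν : Fin 4, ∑ μ, divTerm a b μ ν x = 0) ↔ b = -2 * a := by
  constructor
  · intro h
    -- evaluate at the point `(1,1,1,1)` and `ν = 0`
    have hx : (fun _ : Fin 4 => (1 : ℝ)) ≠ 0 := by
      intro h0
      have := congrFun h0 0
      simp at this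
    have h0 := h _ hx 0
    rw [sum_divTerm a b 0 hx] at h0
    have hr : r2 (fun _ : Fin 4 => (1 : ℝ)) = 4 := by
      norm_num [r2, Fin.sum_univ_four]
    rw [hr] at h0
    norm_num at h0
    linarith
  · rintro rfl x hx ν
    rw [sum_divTerm a (-2 * a) ν hx]
    ring

/-- … and in the divergence-free case the family IS a scalar multiple of `T`: `S^{a,−2a} = (−a/12)·T`. [folklore] -/
theorem covFamily_eq_smul_transverse (a : ℝ) (μ ν : Fin 4) (x : E4) :
    covFamily a (-2 * a) μ ν x = (-a / 12) * transverse μ ν x := by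
  rw [covFamily, transverse_eq]
  split_ifs <;> ring

/-! ## §4. The off-diagonal moment `x_μx_ν·T_{μν}` — the signed degree-(−4) structure of §8.6(p) -/

/-- For `μ ≠ ν`: `x_μ·x_ν·T_{μν}(x) = 24·x_μ²·x_ν²/r2⁴` (= `24x_μ²x_ν²/|x|⁸`). [folklore] -/
theorem offDiag_moment {μ ν : Fin 4} (h : μ ≠ ν) (x : E4) :
    x μ * x ν * transverse μ ν x = 24 * x μ ^ 2 * x ν ^ 2 / r2 x ^ 4 := by
  rw [transverse_eq, if_neg h]
  ring

/-- It is pointwise `≥ 0` … [folklore] -/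
theorem offDiag_moment_nonneg {μ ν : Fin 4} (h : μ ≠ ν) (x : E4) : 0 ≤ x μ * x ν * transverse μ ν x := by
  rw [offDiag_moment h]
  have := r2_nonneg x
  positivity

/-- … `> 0` off the coordinate hyperplanes `x_μ = 0`, `x_ν = 0` … [folklore] -/
theorem offDiag_moment_pos {μ ν : Fin 4} (h : μ ≠ ν) {x : E4} (hμ : x μ ≠ 0) (hν : x ν ≠ 0) :
    0 < x μ * x ν * transverse μ ν x := by
  rw [offDiag_moment h]
  have hx : x ≠ 0 := fun h0 => hμ (by simp [h0])
  have := r2_pos hx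
  positivity

/-- … and positively homogeneous of degree `−4`: the moment at `t • x` is the moment at `x` divided by `t⁴`
(`t ≠ 0`, `x ≠ 0`) — the homogeneity field of `Beta.DyadicShell.HomogKernel`. [folklore] -/
theorem offDiag_moment_smul {μ ν : Fin 4} (h : μ ≠ ν) {t : ℝ} (ht : t ≠ 0) {x : E4} (hx : x ≠ 0) :
    (t • x) μ * (t • x) ν * transverse μ ν (t • x) = x μ * x ν * transverse μ ν x / t ^ 4 := by
  rw [offDiag_moment h, offDiag_moment h, r2_smul]
  have hr : r2 x ≠ 0 := (r2_pos hx).ne'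
  simp only [Pi.smul_apply, smul_eq_mul]
  field_simp

/-- So, for a scalar `κ`, the sign of `κ·x_μx_νT_{μν}` off the hyperplanes is the sign of `κ` — the content of
«I > 0 is EXACTLY κ > 0» at the level of the integrand. [folklore] -/
theorem sign_of_scalar_multiple {μ ν : Fin 4} (h : μ ≠ ν) {x : E4} (hμ : x μ ≠ 0) (hν : x ν ≠ 0) (κ : ℝ) :
    (0 < κ * (x μ * x ν * transverse μ ν x) ↔ 0 < κ) ∧ (κ * (x μ * x ν * transverse μ ν x) < 0 ↔ κ < 0) := by
  have hp := offDiag_moment_pos h hμ hν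
  constructor
  · rw [mul_pos_iff]
    constructor
    · rintro (⟨hk, _⟩ | ⟨_, hneg⟩)
      · exact hk
      · exact absurd hneg (not_lt.mpr hp.le)
    · intro hk
      exact Or.inl ⟨hk, hp⟩
  · rw [mul_neg_iff]
    constructor
    · rintro (⟨_, hneg⟩ | ⟨hk, _⟩)
      · exact absurd hneg (not_lt.mpr hp.le)
      · exact hk
    · intro hk
      exact Or.inr ⟨hk, hp⟩

/-- Non-vacuity / sanity: at `x = (1,1,0,0)`, `r2 = 2`, `T₀₁ = 24/16 = 3/2`, `T₀₀ = 24/16 − 12/8 = 0`. -/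
example : transverse 0 1 (fun i : Fin 4 => if i = 0 ∨ i = 1 then (1 : ℝ) else 0) = 3 / 2 ∧
    transverse 0 0 (fun i : Fin 4 => if i = 0 ∨ i = 1 then (1 : ℝ) else 0) = 0 := by
  have hr : r2 (fun i : Fin 4 => if i = 0 ∨ i = 1 then (1 : ℝ) else 0) = 2 := by
    rw [r2, Fin.sum_univ_four]
    norm_num [Fin.ext_iff]
  constructor <;>
    · rw [transverse_eq, hr]
      norm_num [Fin.ext_iff]


/-! ## §5. (v1.1) THE O(4)-COVARIANCE CLASSIFICATION and the ONE-SCALAR THEOREM as kernel facts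

v1 took the covariant two-parameter family `S^{a,b}` as a HYPOTHESIS ("the covariance CLASSIFICATION is not formalised").
This section proves it.  Objects are matrix fields `S : ℝ⁴ → Matrix (Fin 4) (Fin 4) ℝ`; hypotheses are imposed OFF THE
ORIGIN only.  Route (all elementary linear algebra, [folklore]): a Householder reflection carries `x ≠ 0` to the axis point
`|x|·e₀`; the sign flips of the coordinates `1,2,3` and the transpositions `(1 i)` are orthogonal and fix `e₀`, so covariance
forces `S(|x|e₀) = diag(l, α, α, α)`; conjugating back, `S(x) = α·1 + ((l − α)/|x|²)·x xᵀ` with `α, l` RADIAL (they are entries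
of `S(|x|e₀)`) — no symmetry hypothesis is needed (symmetry is a consequence).  Degree-`(−6)` homogeneity then gives EXACTLY
v1's family `covFamily a b` (`a = S(e₀)₁₁`, `b = S(e₀)₀₀ − S(e₀)₁₁`), and v1's `divFree_iff` finishes: covariant + homogeneous
+ divergence-free ⇒ `S = κ·T`, `κ = −S(e₀)₁₁/12` (`one_scalar`).  Conversely every `κ·T` has the three properties
(`smul_transverseField_*`): the hypotheses cut out exactly the line `ℝ·T`.  The divergence is the honest one: `coordDiv S ν x =
Σ_μ deriv (t ↦ S(update x μ t)_{μν}) (x_μ)`, identified with v1's certified closed forms on a neighbourhood of `x_μ`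
(`coordDiv_eq_sum_divTerm`). -/

open Matrix


/-- `x ⬝ᵥ x = r2 x`. [folklore] -/
theorem dotProduct_self_eq_r2 (x : E4) : x ⬝ᵥ x = r2 x := by
  unfold r2 dotProduct
  exact Finset.sum_congr rfl fun i _ => by ring

/-- the axis point `r e₀`. [folklore] -/
def axisPt (r : ℝ) : E4 := fun i => if i = 0 then r else 0

/-- `axisPt r = r • e₀`. [folklore] -/
theorem axisPt_eq_smul (r : ℝ) : axisPt r = r • axisPt 1 := by
  funext i; simp [axisPt]

/-- `(r e₀) ⬝ᵥ x = r·x₀`. [folklore] -/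
theorem axisPt_dotProduct (r : ℝ) (x : E4) : axisPt r ⬝ᵥ x = r * x 0 := by
  simp [dotProduct, axisPt]

/-- `(u vᵀ) w = (v ⬝ᵥ w)·u`. [folklore] -/
theorem vecMulVec_mulVec_eq (u v w : E4) : vecMulVec u v *ᵥ w = (v ⬝ᵥ w) • u := by
  ext i
  simp only [mulVec, dotProduct, vecMulVec_apply, Pi.smul_apply, smul_eq_mul, Finset.sum_mul]
  exact Finset.sum_congr rfl fun j _ => by ring

/-- **Householder step**: for `x ≠ 0` there is a real orthogonal `A` (`Aᵀ A = 1`) with `A x = |x|·e₀` — the identity if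
`x = |x|e₀`, else the reflection `1 − 2vvᵀ/(v ⬝ᵥ v)`, `v = x − |x|e₀`. [folklore] -/
theorem exists_orthogonal_to_axis {x : E4} (hx : x ≠ 0) :
    ∃ A : Matrix (Fin 4) (Fin 4) ℝ, Aᵀ * A = 1 ∧ A *ᵥ x = axisPt (Real.sqrt (r2 x)) := by
  set r := Real.sqrt (r2 x) with hr
  have hr2 : 0 < r2 x := r2_pos hx
  have hrr : r * r = r2 x := Real.mul_self_sqrt hr2.le
  by_cases hv : x = axisPt r
  · exact ⟨1, by simp, by rw [one_mulVec]; exact hv⟩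
  · set v : E4 := x - axisPt r with hvdef
    have hv0 : v ≠ 0 := sub_ne_zero.mpr hv
    have hvx : v ⬝ᵥ x = r2 x - r * x 0 := by
      rw [hvdef, sub_dotProduct, dotProduct_self_eq_r2, axisPt_dotProduct]
    have hvv : v ⬝ᵥ v = 2 * (v ⬝ᵥ x) := by
      rw [hvx, hvdef, sub_dotProduct, dotProduct_sub, dotProduct_sub, dotProduct_self_eq_r2, axisPt_dotProduct,
        dotProduct_comm x (axisPt r), axisPt_dotProduct, dotProduct_self_eq_r2]
      have : r2 (axisPt r) = r * r := by simp [r2, axisPt, sq]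
      rw [this, hrr]
      ring
    have hvv_pos : 0 < v ⬝ᵥ v := by
      rw [dotProduct_self_eq_r2]
      exact r2_pos hv0
    have hvx_ne : v ⬝ᵥ x ≠ 0 := by
      intro h0; rw [h0, mul_zero] at hvv; exact hvv_pos.ne' hvv
    set c : ℝ := 2 / (v ⬝ᵥ v) with hc
    have hcvv : c * (v ⬝ᵥ v) = 2 := by
      rw [hc]; field_simp
    have hcvx : c * (v ⬝ᵥ x) = 1 := by
      have : c * (v ⬝ᵥ v) = 2 * (c * (v ⬝ᵥ x)) := by rw [hvv]; ring
      linarith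
    refine ⟨1 - c • vecMulVec v v, ?_, ?_⟩
    · have hT : (1 - c • vecMulVec v v)ᵀ = 1 - c • vecMulVec v v := by
        rw [transpose_sub, transpose_one, transpose_smul, transpose_vecMulVec]
      rw [hT]
      have hVV : vecMulVec v v * vecMulVec v v = (v ⬝ᵥ v) • vecMulVec v v := by
        rw [vecMulVec_mul_vecMulVec, vecMulVec_smul]
      have hcc : (c * c * (v ⬝ᵥ v)) = 2 * c := by
        calc c * c * (v ⬝ᵥ v) = c * (c * (v ⬝ᵥ v)) := by ring
          _ = 2 * c := by rw [hcvv]; ring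
      calc (1 - c • vecMulVec v v) * (1 - c • vecMulVec v v)
          = 1 - c • vecMulVec v v - c • vecMulVec v v + (c * c * (v ⬝ᵥ v)) • vecMulVec v v := by
            simp only [sub_mul, mul_sub, one_mul, mul_one, Matrix.smul_mul, Matrix.mul_smul, hVV, smul_smul]
            module
        _ = 1 := by rw [hcc]; module
    · rw [sub_mulVec, one_mulVec, smul_mulVec, vecMulVec_mulVec_eq, smul_smul, hcvx, one_smul, hvdef]
      abel


/-- A matrix-valued kernel. [folklore] -/
abbrev TensorField : Type := E4 → Matrix (Fin 4) (Fin 4) ℝ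

/-- O(4)-covariance off the origin. [folklore] -/
def IsO4Covariant (S : TensorField) : Prop :=
  ∀ A : Matrix (Fin 4) (Fin 4) ℝ, Aᵀ * A = 1 → ∀ x : E4, x ≠ 0 → S (A *ᵥ x) = A * S x * Aᵀ

/-- `r ≠ 0 ⇒ r e₀ ≠ 0`. [folklore] -/
theorem axisPt_ne_zero {r : ℝ} (hr : r ≠ 0) : axisPt r ≠ 0 := by
  intro h
  have := congrFun h 0
  simp [axisPt] at this
  exact hr this

/-- sign flip of the `j`-th coordinate [folklore] -/
def flipMat (j : Fin 4) : Matrix (Fin 4) (Fin 4) ℝ := diagonal fun i => if i = j then -1 else 1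

/-- Sign flips are orthogonal. [folklore] -/
theorem flipMat_orthogonal (j : Fin 4) : (flipMat j)ᵀ * flipMat j = 1 := by
  rw [flipMat, diagonal_transpose, diagonal_mul_diagonal, ← diagonal_one]
  congr 1
  funext i
  split_ifs <;> norm_num

/-- Sign flips of the coordinates `1, 2, 3` fix the axis point. [folklore] -/
theorem flipMat_mulVec_axisPt {j : Fin 4} (hj : j ≠ 0) (r : ℝ) : flipMat j *ᵥ axisPt r = axisPt r := by
  ext i
  rw [flipMat, mulVec_diagonal]
  by_cases hi : i = 0
  · subst hi
    simp [axisPt, Ne.symm hj]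
  · simp [axisPt, hi]

/-- Entries of a flip-conjugated matrix: `(D_j M D_j)_{ik} = ε_i ε_k M_{ik}`. [folklore] -/
theorem flip_conj_apply (j : Fin 4) (M : Matrix (Fin 4) (Fin 4) ℝ) (i k : Fin 4) :
    (flipMat j * M * (flipMat j)ᵀ) i k
      = (if i = j then -1 else 1) * M i k * (if k = j then -1 else 1) := by
  simp only [flipMat, diagonal_transpose, mul_diagonal, diagonal_mul]

/-- Under covariance the off-diagonal entries of `S` at an axis point vanish. [folklore] -/
theorem offDiag_zero_at_axis {S : TensorField} (hS : IsO4Covariant S) {r : ℝ} (hr : r ≠ 0) {i k : Fin 4}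
    (hik : i ≠ k) : S (axisPt r) i k = 0 := by
  -- pick a flipped index `j ∈ {i, k}` with `j ≠ 0`
  obtain ⟨j, hj0, hj⟩ : ∃ j : Fin 4, j ≠ 0 ∧ ((i = j ∧ k ≠ j) ∨ (i ≠ j ∧ k = j)) := by
    by_cases hi : i = 0
    · exact ⟨k, fun h => hik (hi.trans h.symm), Or.inr ⟨fun h => hik (h ▸ rfl) |>.elim, rfl⟩⟩
    · exact ⟨i, hi, Or.inl ⟨rfl, fun h => hik h.symm⟩⟩
  have hcov := hS (flipMat j) (flipMat_orthogonal j) (axisPt r) (axisPt_ne_zero hr)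
  rw [flipMat_mulVec_axisPt hj0] at hcov
  have h := congrFun (congrFun hcov i) k
  rw [flip_conj_apply] at h
  rcases hj with ⟨hij, hkj⟩ | ⟨hij, hkj⟩
  · rw [if_pos hij, if_neg hkj] at h
    linarith
  · rw [if_neg hij, if_pos hkj] at h
    linarith

/-- the permutation matrix of `σ`: `(permMat σ *ᵥ v) i = v (σ i)`. [folklore] -/
def permMat (σ : Equiv.Perm (Fin 4)) : Matrix (Fin 4) (Fin 4) ℝ := Matrix.of fun i j => if j = σ i then 1 else 0

/-- `(P_σ v)_i = v_{σ i}`. [folklore] -/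
theorem permMat_mulVec (σ : Equiv.Perm (Fin 4)) (v : E4) (i : Fin 4) : (permMat σ *ᵥ v) i = v (σ i) := by
  simp [permMat, mulVec, dotProduct]

/-- `(P_σ M)_{ik} = M_{σ i, k}`. [folklore] -/
theorem permMat_mul_apply (σ : Equiv.Perm (Fin 4)) (M : Matrix (Fin 4) (Fin 4) ℝ) (i k : Fin 4) :
    (permMat σ * M) i k = M (σ i) k := by
  simp [permMat, Matrix.mul_apply]

/-- `(P_σ M P_σᵀ)_{ik} = M_{σ i, σ k}`. [folklore] -/
theorem perm_conj_apply (σ : Equiv.Perm (Fin 4)) (M : Matrix (Fin 4) (Fin 4) ℝ) (i k : Fin 4) :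
    (permMat σ * M * (permMat σ)ᵀ) i k = M (σ i) (σ k) := by
  rw [Matrix.mul_apply]
  simp only [transpose_apply, permMat_mul_apply]
  simp [permMat]

/-- Permutation matrices are orthogonal. [folklore] -/
theorem permMat_orthogonal (σ : Equiv.Perm (Fin 4)) : (permMat σ)ᵀ * permMat σ = 1 := by
  ext j k
  simp only [Matrix.mul_apply, transpose_apply, permMat, Matrix.of_apply, Matrix.one_apply]
  rw [Finset.sum_eq_single (σ.symm j)]
  · simp only [Equiv.apply_symm_apply, if_true, one_mul]
    by_cases hjk : j = k
    · simp [hjk]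
    · rw [if_neg hjk, if_neg (Ne.symm hjk)]
  · intro b _ hb
    have : j ≠ σ b := fun h => hb (by rw [h, Equiv.symm_apply_apply])
    rw [if_neg this, zero_mul]
  · intro h
    exact absurd (Finset.mem_univ _) h

/-- A permutation fixing the index `0` fixes the axis point. [folklore] -/
theorem permMat_mulVec_axisPt {σ : Equiv.Perm (Fin 4)} (hσ : σ 0 = 0) (r : ℝ) : permMat σ *ᵥ axisPt r = axisPt r := by
  ext i
  rw [permMat_mulVec]
  by_cases hi : i = 0
  · subst hi; simp [axisPt, hσ]
  · have : σ i ≠ 0 := fun h => hi (σ.injective (h.trans hσ.symm))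
    simp [axisPt, hi, this]

/-- Under covariance the diagonal entries `1,2,3` of `S` at an axis point agree. [folklore] -/
theorem diag_eq_at_axis {S : TensorField} (hS : IsO4Covariant S) {r : ℝ} (hr : r ≠ 0) {i : Fin 4} (hi : i ≠ 0) :
    S (axisPt r) i i = S (axisPt r) 1 1 := by
  set σ : Equiv.Perm (Fin 4) := Equiv.swap 1 i
  have hσ0 : σ 0 = 0 := Equiv.swap_apply_of_ne_of_ne (by decide) (Ne.symm hi)
  have hcov := hS (permMat σ) (permMat_orthogonal σ) (axisPt r) (axisPt_ne_zero hr)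
  rw [permMat_mulVec_axisPt hσ0] at hcov
  have h := congrFun (congrFun hcov 1) 1
  rw [perm_conj_apply] at h
  have h1 : σ 1 = i := Equiv.swap_apply_left 1 i
  rw [h1] at h
  exact h.symm


/-- The value of `S` at the axis point `|x| e₀` is diagonal `diag(l, α, α, α)`. [folklore] -/
theorem axis_form {S : TensorField} (hS : IsO4Covariant S) {r : ℝ} (hr : r ≠ 0) :
    S (axisPt r) = (S (axisPt r) 1 1) • (1 : Matrix (Fin 4) (Fin 4) ℝ)
      + (S (axisPt r) 0 0 - S (axisPt r) 1 1) • vecMulVec (axisPt 1) (axisPt 1) := by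
  ext i k
  rw [Matrix.add_apply, Matrix.smul_apply, Matrix.smul_apply, vecMulVec_apply, Matrix.one_apply]
  simp only [axisPt, smul_eq_mul, mul_ite, mul_one, mul_zero]
  by_cases hik : i = k
  · subst hik
    by_cases hi : i = 0
    · subst hi; simp
    · rw [if_pos rfl, if_neg hi, diag_eq_at_axis hS hr hi]; ring
  · rw [offDiag_zero_at_axis hS hr hik, if_neg hik]
    by_cases hk : k = 0
    · subst hk
      rw [if_pos rfl, if_neg hik]; ring
    · rw [if_neg hk]; ring

/-- **O(4)-COVARIANCE CLASSIFICATION (matrix form).** [folklore] -/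
theorem o4_classification {S : TensorField} (hS : IsO4Covariant S) {x : E4} (hx : x ≠ 0) :
    S x = (S (axisPt (Real.sqrt (r2 x))) 1 1) • (1 : Matrix (Fin 4) (Fin 4) ℝ)
      + ((S (axisPt (Real.sqrt (r2 x))) 0 0 - S (axisPt (Real.sqrt (r2 x))) 1 1) / r2 x) • vecMulVec x x := by
  obtain ⟨A, hA, hAx⟩ := exists_orthogonal_to_axis hx
  set r := Real.sqrt (r2 x) with hrdef
  have hr : 0 < r := Real.sqrt_pos.mpr (r2_pos hx)
  have hrr : r * r = r2 x := Real.mul_self_sqrt (r2_pos hx).le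
  set M := S (axisPt r) with hMdef
  set α := M 1 1
  set l := M 0 0
  have hcov : M = A * S x * Aᵀ := by
    have h := hS A hA x hx
    rw [hAx] at h
    exact h
  have hSx : S x = Aᵀ * M * A := by
    calc S x = (Aᵀ * A) * S x * (Aᵀ * A) := by rw [hA, Matrix.one_mul, Matrix.mul_one]
      _ = Aᵀ * (A * S x * Aᵀ) * A := by simp only [Matrix.mul_assoc]
      _ = Aᵀ * M * A := by rw [← hcov]
  have hM : M = α • (1 : Matrix (Fin 4) (Fin 4) ℝ) + (l - α) • vecMulVec (axisPt 1) (axisPt 1) :=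
    axis_form hS hr.ne'
  -- `Aᵀ e₀ = r⁻¹ x`
  have hAe : Aᵀ *ᵥ axisPt 1 = r⁻¹ • x := by
    have h1 : Aᵀ *ᵥ (A *ᵥ x) = x := by rw [mulVec_mulVec, hA, one_mulVec]
    rw [hAx, axisPt_eq_smul r, mulVec_smul] at h1
    -- h1 : r • (Aᵀ *ᵥ axisPt 1) = x
    rw [← h1, smul_smul, inv_mul_cancel₀ hr.ne', one_smul]
  have hAeT : axisPt 1 ᵥ* A = r⁻¹ • x := by
    rw [← mulVec_transpose]; exact hAe
  rw [hSx, hM, Matrix.mul_add, Matrix.add_mul, Matrix.mul_smul, Matrix.smul_mul, Matrix.mul_one, hA,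
    Matrix.mul_smul, Matrix.smul_mul, mul_vecMulVec, vecMulVec_mul, hAe, hAeT, smul_vecMulVec, vecMulVec_smul,
    smul_smul, smul_smul]
  congr 1
  congr 1
  rw [← hrr]
  field_simp

/-- **O(4)-COVARIANCE CLASSIFICATION (entries).**  With the radial functions `α(|x|) := S(|x|e₀)₁₁`,
`β(|x|) := (S(|x|e₀)₀₀ − S(|x|e₀)₁₁)/|x|²`: `S(x)_{μν} = β(|x|)·x_μx_ν + α(|x|)·δ_{μν}`. [folklore] -/
theorem o4_classification_apply {S : TensorField} (hS : IsO4Covariant S) {x : E4} (hx : x ≠ 0) (μ ν : Fin 4) :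
    S x μ ν = (S (axisPt (Real.sqrt (r2 x))) 0 0 - S (axisPt (Real.sqrt (r2 x))) 1 1) / r2 x * x μ * x ν
      + if μ = ν then S (axisPt (Real.sqrt (r2 x))) 1 1 else 0 := by
  rw [o4_classification hS hx, Matrix.add_apply, Matrix.smul_apply, Matrix.smul_apply, vecMulVec_apply,
    Matrix.one_apply]
  simp only [smul_eq_mul, mul_ite, mul_one, mul_zero]
  ring


/-- Positive homogeneity of degree `−6` off the origin. [folklore] -/
def IsHomogNegSix (S : TensorField) : Prop :=
  ∀ t : ℝ, 0 < t → ∀ x : E4, x ≠ 0 → S (t • x) = (t ^ 6)⁻¹ • S x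

/-- **CLASSIFICATION + HOMOGENEITY ⇒ the two-parameter family `covFamily a b`** with `a = S(e₀)₁₁`,
`b = S(e₀)₀₀ − S(e₀)₁₁`. [folklore] -/
theorem eq_covFamily_of_covariant {S : TensorField} (hS : IsO4Covariant S) (hH : IsHomogNegSix S) {x : E4}
    (hx : x ≠ 0) (μ ν : Fin 4) :
    S x μ ν = covFamily (S (axisPt 1) 1 1) (S (axisPt 1) 0 0 - S (axisPt 1) 1 1) μ ν x := by
  set r := Real.sqrt (r2 x) with hrdef
  have hr : 0 < r := Real.sqrt_pos.mpr (r2_pos hx)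
  have hr2 : r ^ 2 = r2 x := Real.sq_sqrt (r2_pos hx).le
  have hr6 : r ^ 6 = r2 x ^ 3 := by rw [← hr2]; ring
  have hne : r2 x ≠ 0 := (r2_pos hx).ne'
  have hax : ∀ i j, S (axisPt r) i j = (r ^ 6)⁻¹ * S (axisPt 1) i j := by
    intro i j
    have h := hH r hr (axisPt 1) (axisPt_ne_zero one_ne_zero)
    rw [← axisPt_eq_smul] at h
    rw [h, Matrix.smul_apply, smul_eq_mul]
  rw [o4_classification_apply hS hx, hax, hax, covFamily, hr6]
  split_ifs <;> field_simp

/-- The coordinate divergence `Σ_μ ∂_μ S_{μν}` of a matrix field, each partial taken as the one-variable derivative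
along the coordinate line `t ↦ update x μ t` at `t = x_μ`. [folklore] -/
def coordDiv (S : TensorField) (ν : Fin 4) (x : E4) : ℝ :=
  ∑ μ, deriv (fun t => S (Function.update x μ t) μ ν) (x μ)

/-- Divergence-free off the origin. [folklore] -/
def IsDivFree (S : TensorField) : Prop := ∀ x : E4, x ≠ 0 → ∀ ν : Fin 4, coordDiv S ν x = 0

/-- If `S` agrees with `covFamily a b` off the origin, its coordinate divergence there IS the certified closed form
`Σ_μ divTerm a b μ ν` (by `hasDerivAt_covFamily`; the two functions of `t` agree on a neighbourhood of `x_μ`). [folklore] -/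
theorem coordDiv_eq_sum_divTerm {S : TensorField} {a b : ℝ}
    (h : ∀ x : E4, x ≠ 0 → ∀ μ ν : Fin 4, S x μ ν = covFamily a b μ ν x) {x : E4} (hx : x ≠ 0) (ν : Fin 4) :
    coordDiv S ν x = ∑ μ, divTerm a b μ ν x := by
  unfold coordDiv
  refine Finset.sum_congr rfl fun μ _ => ?_
  refine ((hasDerivAt_covFamily a b μ ν hx).congr_of_eventuallyEq ?_).deriv
  -- the two functions agree near `x_μ`
  by_cases hμ : x μ = 0
  · -- some other coordinate is nonzero, so the whole line avoids the origin
    refine Filter.Eventually.of_forall fun t => ?_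
    refine h _ ?_ μ ν
    obtain ⟨i, hi⟩ : ∃ i, x i ≠ 0 := by
      by_contra h0
      push Not at h0
      exact hx (funext h0)
    have hiμ : i ≠ μ := fun e => hi (e ▸ hμ)
    intro h0
    have := congrFun h0 i
    rw [Function.update_of_ne hiμ] at this
    exact hi this
  · -- the line avoids the origin for `t ≠ 0`, a neighbourhood of `x_μ ≠ 0`
    refine Filter.eventuallyEq_of_mem (isOpen_ne.mem_nhds hμ) fun t ht => ?_
    refine h _ ?_ μ ν
    intro h0
    have := congrFun h0 μ
    rw [Function.update_self] at this
    exact ht this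

/-- **THE ONE-SCALAR THEOREM (kernel form of AN3 §6.2 / LIT1 §9.1 «WHY ONE SCALAR»).**  A matrix field on `ℝ⁴ ∖ 0` that is
O(4)-covariant, positively homogeneous of degree `−6` and divergence-free is `κ·T` with `κ = −S(e₀)₁₁/12`. [folklore] -/
theorem one_scalar {S : TensorField} (hS : IsO4Covariant S) (hH : IsHomogNegSix S) (hD : IsDivFree S) {x : E4}
    (hx : x ≠ 0) (μ ν : Fin 4) : S x μ ν = (-(S (axisPt 1) 1 1) / 12) * transverse μ ν x := by
  set a := S (axisPt 1) 1 1
  set b := S (axisPt 1) 0 0 - S (axisPt 1) 1 1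
  have hfam : ∀ y : E4, y ≠ 0 → ∀ μ ν : Fin 4, S y μ ν = covFamily a b μ ν y :=
    fun y hy μ ν => eq_covFamily_of_covariant hS hH hy μ ν
  have hb : b = -2 * a := by
    refine (divFree_iff a b).mp fun y hy ν' => ?_
    rw [← coordDiv_eq_sum_divTerm hfam hy ν']
    exact hD y hy ν'
  rw [hfam x hx μ ν, hb, covFamily_eq_smul_transverse]

/-! ### The model: `T` itself satisfies the three hypotheses (non-vacuity; the hypotheses pin down exactly `ℝ·T`). -/

/-- `T` as a matrix field. [folklore] -/
def transverseField : TensorField := fun x => Matrix.of fun μ ν => transverse μ ν x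

/-- Matrix closed form: `T(x) = (24/r2⁴)·x xᵀ − (12/r2³)·1` (`transverse_eq`). [folklore] -/
theorem transverseField_eq (x : E4) :
    transverseField x = (24 / r2 x ^ 4) • vecMulVec x x - (12 / r2 x ^ 3) • (1 : Matrix (Fin 4) (Fin 4) ℝ) := by
  ext μ ν
  rw [transverseField, Matrix.of_apply, transverse_eq, Matrix.sub_apply, Matrix.smul_apply, Matrix.smul_apply,
    vecMulVec_apply, Matrix.one_apply]
  simp only [smul_eq_mul, mul_ite, mul_one, mul_zero]
  ring

/-- Orthogonal maps preserve `r2`. [folklore] -/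
theorem r2_mulVec_of_orthogonal {A : Matrix (Fin 4) (Fin 4) ℝ} (hA : Aᵀ * A = 1) (x : E4) : r2 (A *ᵥ x) = r2 x := by
  rw [← dotProduct_self_eq_r2, ← dotProduct_self_eq_r2, dotProduct_mulVec, ← mulVec_transpose, mulVec_mulVec, hA,
    one_mulVec]

/-- `T` is O(4)-covariant … [folklore] -/
theorem transverseField_covariant : IsO4Covariant transverseField := by
  intro A hA x _
  have hA' : A * Aᵀ = 1 := mul_eq_one_comm.mp hA
  rw [transverseField_eq, transverseField_eq, r2_mulVec_of_orthogonal hA, Matrix.mul_sub, Matrix.sub_mul,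
    Matrix.mul_smul, Matrix.smul_mul, Matrix.mul_smul, Matrix.smul_mul, Matrix.mul_one, hA', mul_vecMulVec,
    vecMulVec_mul, vecMul_transpose]

/-- … positively homogeneous of degree `−6` … [folklore] -/
theorem transverseField_homog : IsHomogNegSix transverseField := by
  intro t ht x hx
  have hne : r2 x ≠ 0 := (r2_pos hx).ne'
  have ht0 : t ≠ 0 := ht.ne'
  ext μ ν
  simp only [transverseField, Matrix.of_apply, Matrix.smul_apply, smul_eq_mul, transverse_eq, r2_smul, Pi.smul_apply]
  split_ifs <;> first | (field_simp; ring) | field_simp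

/-- … and divergence-free off the origin (each partial certified by `hasDerivAt_transverse`). [folklore] -/
theorem transverseField_divFree : IsDivFree transverseField := by
  intro x hx ν
  unfold coordDiv transverseField
  simp only [Matrix.of_apply]
  rw [show (∑ μ, deriv (fun t => transverse μ ν (Function.update x μ t)) (x μ)) = ∑ μ, divTerm (-12) 24 μ ν x from
    Finset.sum_congr rfl fun μ _ => (hasDerivAt_transverse μ ν hx).deriv]
  exact transverse_divFree ν hx

/-- … and for the model the scalar of `one_scalar` is `−T(e₀)₁₁/12 = −(−12)/12 = 1`, as it must be. [folklore] -/
example : -(transverseField (axisPt 1) 1 1) / 12 = 1 := by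
  rw [transverseField, Matrix.of_apply, transverse_eq]
  have : r2 (axisPt 1) = 1 := by simp [r2, axisPt]
  rw [this]
  norm_num [axisPt]


/-- Matrix form of `one_scalar`: off the origin `S = κ • T` with `κ = −S(e₀)₁₁/12`. [folklore] -/
theorem one_scalar_matrix {S : TensorField} (hS : IsO4Covariant S) (hH : IsHomogNegSix S) (hD : IsDivFree S) {x : E4}
    (hx : x ≠ 0) : S x = (-(S (axisPt 1) 1 1) / 12) • transverseField x := by
  ext μ ν
  rw [one_scalar hS hH hD hx μ ν, Matrix.smul_apply, transverseField, Matrix.of_apply, smul_eq_mul]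

/-- Conversely every `κ • T` is O(4)-covariant … [folklore] -/
theorem smul_transverseField_covariant (κ : ℝ) : IsO4Covariant fun x => κ • transverseField x := by
  intro A hA x hx
  show κ • transverseField (A *ᵥ x) = A * (κ • transverseField x) * Aᵀ
  rw [transverseField_covariant A hA x hx, Matrix.mul_smul, Matrix.smul_mul]

/-- … homogeneous of degree `−6` … [folklore] -/
theorem smul_transverseField_homog (κ : ℝ) : IsHomogNegSix fun x => κ • transverseField x := by
  intro t ht x hx
  show κ • transverseField (t • x) = (t ^ 6)⁻¹ • (κ • transverseField x)
  rw [transverseField_homog t ht x hx, smul_comm]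

/-- … and divergence-free off the origin: the three hypotheses of `one_scalar` cut out EXACTLY the line `ℝ·T`. [folklore] -/
theorem smul_transverseField_divFree (κ : ℝ) : IsDivFree fun x => κ • transverseField x := by
  intro x hx ν
  unfold coordDiv transverseField
  simp only [Matrix.smul_apply, Matrix.of_apply, smul_eq_mul]
  rw [show (∑ μ, deriv (fun t => κ * transverse μ ν (Function.update x μ t)) (x μ))
      = ∑ μ, κ * divTerm (-12) 24 μ ν x from
    Finset.sum_congr rfl fun μ _ => ((hasDerivAt_transverse μ ν hx).const_mul κ).deriv,
    ← Finset.mul_sum, transverse_divFree ν hx, mul_zero]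

/-! ## §6. (v1.1) The LOCAL hypercubic family `P^{a,b,c}(∂)|x|⁻⁴` — which anisotropy transversality kills, and which it does not

Bałaban's kernels are covariant only under the HYPERCUBIC group (B12 (1.21): lattice rotations), under which the symmetric
constant-coefficient second-order operators form the THREE-parameter family `P^{a,b,c}_{μν}(∂) = a·δ_{μν}Δ + b·∂_μ∂_ν +
c·δ_{μν}∂_μ²` (the extra, non-O(4) member is the anisotropic `δ_{μν}∂_μ²`; in momentum space `a p²δ + b p_μp_ν + c δ_{μν}p_μ²`,
the general hypercubic-covariant POLYNOMIAL log-coefficient).  This section certifies the divergence of the local kernels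
`L^{a,b,c} := P^{a,b,c}(∂)|x|⁻⁴` (assembled from §2's certified partials) — `Σ_μ∂_μL_{μν} = (−48a − 48b + 72c)·x_ν/r2⁴ −
192c·x_ν³/r2⁵` — and proves: `L^{a,b,c}` is divergence-free on `ℝ⁴ ∖ 0` iff `c = 0 ∧ a = −b`, i.e. iff `L = b·T`
(`localFamily_divFree_iff`, `localFamily_maxwell`).  So for kernels of LOCAL form (polynomial log-coefficient) hypercubic
covariance + transversality already leave one scalar.  HONEST SCOPE [analysis, not formalised]: the hypercubic-covariant,
transverse, degree-`(−6)` kernels NOT of this form are exactly the reason AN3.md v3 §6.2's caveat stands — e.g.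
`(∂_μ∂_ν − δ_{μν}Δ)φ` with `φ = Σ_λ x_λ⁴/|x|⁸` is transverse for trivial reasons and is not a multiple of `T`; such NON-LOCAL
anisotropies (momentum space: `(p_μp_ν − p²δ)·Y₄(p̂)`, no logarithm) are excluded from the LEADING window kernel only by the
content of rows (L1)(β)/(L2) (continuum-like leading symbols), not by symmetry.  Nothing about Bałaban's kernels is asserted. -/

/-- The local hypercubic three-parameter family: `L^{a,b,c}_{μν} := (a·δ_{μν}Δ + b·∂_μ∂_ν + c·δ_{μν}∂_μ²)|x|⁻⁴`,
ASSEMBLED FROM THE CERTIFIED CLOSED FORMS of §2 (`hessInvQuartic`, `lapInvQuartic`). [folklore] -/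
def localFamily (a b c : ℝ) (μ ν : Fin 4) (x : E4) : ℝ :=
  b * hessInvQuartic μ ν x + if μ = ν then a * lapInvQuartic x + c * hessInvQuartic μ μ x else 0

/-- Closed form: `L^{a,b,c}_{μν} = S^{8a−4b−4c, 24b}_{μν} + δ_{μν}·24c·x_μ²/r2⁴` — the covariant family plus the
anisotropic diagonal term. [folklore] -/
theorem localFamily_eq (a b c : ℝ) (μ ν : Fin 4) (x : E4) :
    localFamily a b c μ ν x
      = covFamily (8 * a - 4 * b - 4 * c) (24 * b) μ ν x + if μ = ν then 24 * c * x μ ^ 2 / r2 x ^ 4 else 0 := by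
  unfold localFamily covFamily hessInvQuartic lapInvQuartic
  by_cases h : μ = ν
  · subst h; simp only [if_true]; ring
  · simp only [if_neg h]; ring

/-- `c = 0`, `a = −b`: the local family IS `b·T`. [folklore] -/
theorem localFamily_maxwell (b : ℝ) (μ ν : Fin 4) (x : E4) : localFamily (-b) b 0 μ ν x = b * transverse μ ν x := by
  unfold localFamily transverse
  by_cases h : μ = ν
  · subst h; simp only [if_true]; ring
  · simp only [if_neg h]; ring

/-- Closed form of the divergence terms `∂_μ L^{a,b,c}_{μν}` (no sum): the covariant part's `divTerm` plus, on the
diagonal, `d/dx_ν (24c·x_ν²/r2⁴) = 48c·x_ν/r2⁴ − 192c·x_ν³/r2⁵`. [folklore] -/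
def divTermLocal (a b c : ℝ) (μ ν : Fin 4) (x : E4) : ℝ :=
  divTerm (8 * a - 4 * b - 4 * c) (24 * b) μ ν x
    + if μ = ν then 48 * c * x ν / r2 x ^ 4 - 192 * c * x ν ^ 3 / r2 x ^ 5 else 0

/-- **Divergence terms of the local family, certified** along coordinate lines. [folklore] -/
theorem hasDerivAt_localFamily (a b c : ℝ) (μ ν : Fin 4) {x : E4} (hx : x ≠ 0) :
    HasDerivAt (fun t => localFamily a b c μ ν (Function.update x μ t)) (divTermLocal a b c μ ν x) (x μ) := by
  have hcov := hasDerivAt_covFamily (8 * a - 4 * b - 4 * c) (24 * b) μ ν hx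
  by_cases hμν : μ = ν
  · subst hμν
    have hne := sq_add_rest_ne_zero μ hx
    have h4 := hasDerivAt_invPow4 (rest μ x) (x μ) hne
    have hextra : HasDerivAt (fun t : ℝ => 24 * c * (t ^ 2 * ((t ^ 2 + rest μ x) ^ 4)⁻¹))
        (48 * c * x μ / r2 x ^ 4 - 192 * c * x μ ^ 3 / r2 x ^ 5) (x μ) := by
      refine (((hasDerivAt_pow 2 (x μ)).fun_mul h4).const_mul (24 * c)).congr_deriv ?_
      rw [r2_eq_sq_add_rest μ x]
      norm_num
      field_simp
      ring
    have hfun : (fun t => localFamily a b c μ μ (Function.update x μ t)) =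
        fun t => covFamily (8 * a - 4 * b - 4 * c) (24 * b) μ μ (Function.update x μ t)
          + 24 * c * (t ^ 2 * ((t ^ 2 + rest μ x) ^ 4)⁻¹) := by
      funext t
      rw [localFamily_eq, if_pos rfl, r2_update, Function.update_self]
      ring
    rw [hfun]
    refine (hcov.add hextra).congr_deriv ?_
    rw [divTermLocal, if_pos rfl]
  · have hfun : (fun t => localFamily a b c μ ν (Function.update x μ t)) =
        fun t => covFamily (8 * a - 4 * b - 4 * c) (24 * b) μ ν (Function.update x μ t) := by
      funext t
      rw [localFamily_eq, if_neg hμν, add_zero]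
    rw [hfun]
    refine hcov.congr_deriv ?_
    rw [divTermLocal, if_neg hμν, add_zero]

/-- **THE DIVERGENCE OF THE LOCAL FAMILY**:
`Σ_μ ∂_μ L^{a,b,c}_{μν} = (−48a − 48b + 72c)·x_ν/r2⁴ − 192c·x_ν³/r2⁵`. [folklore] -/
theorem sum_divTermLocal (a b c : ℝ) (ν : Fin 4) {x : E4} (hx : x ≠ 0) :
    ∑ μ, divTermLocal a b c μ ν x
      = ((-48) * a - 48 * b + 72 * c) * x ν / r2 x ^ 4 - 192 * c * x ν ^ 3 / r2 x ^ 5 := by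
  unfold divTermLocal
  rw [Finset.sum_add_distrib, sum_divTerm _ _ ν hx, Finset.sum_ite_eq' Finset.univ ν, if_pos (Finset.mem_univ ν)]
  ring

/-- **ONE SCALAR UNDER HYPERCUBIC COVARIANCE, FOR LOCAL KERNELS**: the local family is divergence-free on `ℝ⁴ ∖ 0`
iff `c = 0 ∧ a = −b`, i.e. iff it is `b·T` (`localFamily_maxwell`). [folklore] -/
theorem localFamily_divFree_iff (a b c : ℝ) :
    (∀ x : E4, x ≠ 0 → ∀ ν : Fin 4, ∑ μ, divTermLocal a b c μ ν x = 0) ↔ c = 0 ∧ a = -b := by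
  constructor
  · intro h
    have hx1 : (fun _ : Fin 4 => (1 : ℝ)) ≠ 0 := by
      intro h0; have := congrFun h0 0; simp at this
    have hx2 : axisPt 1 ≠ 0 := axisPt_ne_zero one_ne_zero
    have h1 := h _ hx1 0
    have h2 := h _ hx2 0
    rw [sum_divTermLocal a b c 0 hx1] at h1
    rw [sum_divTermLocal a b c 0 hx2] at h2
    have hr1 : r2 (fun _ : Fin 4 => (1 : ℝ)) = 4 := by norm_num [r2, Fin.sum_univ_four]
    have hr2 : r2 (axisPt 1) = 1 := by simp [r2, axisPt]
    rw [hr1] at h1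
    rw [hr2] at h2
    simp only [axisPt, if_true] at h2
    norm_num at h1 h2
    constructor <;> linarith
  · rintro ⟨rfl, rfl⟩ x hx ν
    rw [sum_divTermLocal _ _ _ ν hx]
    ring

end

end Literature.MathematicalPhysics.QuantumFieldTheory.Balaban1983to89.Beta.TransverseStructure
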